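import Mathlib.NumberTheory.Height.NumberField
import Mathlib.NumberTheory.Height.MvPolynomial
import Mathlib.Analysis.SpecialFunctions.Log.Basic
import Literature.NumberTheory.Transcendental.HeightLocalGlobal
import HarnessLib

/-!
# Small value estimates at rational translates (Nguyen–Roy 2016) — proofs, XIV: the Weil height of a translate (Lemma 11, height half)

Fourteenth proofs file towards `Literature.NumberTheory.Transcendental.nguyenRoy2016_thm_1` (Nguyen–Roy,
IJNT 12 (2016) = arXiv:1412.5163). Everything here is PROVED; no named facts. It supplies the
diophantine input of **Lemma 11** of the paper (`|h(τⁱZ) − h(Z)| ≤ c₄|i| deg Z`): the printed proof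
compares `h(Z)` with the absolute logarithmic Weil height `h_abs(α)` of a point `α` of `Z` and
bounds `h_abs(τ̲α) ≤ c + h_abs(α)` place by place
("`‖τ̲(α)‖_v ≤ 2^{ε_v} max{1,|r|_v} max{1,|s|_v} ‖α‖_v`"). We prove this Weil-height half, for the
iterates `τ̲ⁱ` directly and with an explicit constant, for Mathlib's logarithmic height
`Height.logHeight` of tuples over a number field `K` (relative to `K`, i.e. `[K:ℚ] · h_abs`):

* `logHeight_intCast_le` — an integer tuple `z ≠ 0` with `|zᵢ| ≤ B` has
  `logHeight_K(z) ≤ totalWeight K · log B` (finite places contribute `≤ 1`, each archimedean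
  absolute value of the admissible family at most `B`; `totalWeight K = [K:ℚ]`);
* `logHeight_intMatrix_apply_le` — for an integer matrix `Z` with `|Z_{jk}| ≤ B`:
  `logHeight_K(Z x) ≤ totalWeight K · (log #ι + log B) + logHeight_K(x)` (Mathlib's
  `Height.logHeight_linearMap_apply_le` plus the previous item);
* `exists_int_clearing` — for `r, s ∈ ℚ`, `s ≠ 0`, `i ∈ ℤ`: integers `N ≥ 1`, `U = N·ir`, `V = N·sⁱ`
  with `N, |U|, |V| ≤ exp(c (|i| + 1))`, `c = tauHtConst r s`
  (`N = d^{|i|+1}`, `d = den(r)·den(s)·|num(s)|`);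
* `logHeight_tauVecK_le` — **the height of a translate**: for `α ∈ K³`,
  `logHeight_K(τ̲ⁱα) ≤ logHeight_K(α) + totalWeight K · (log 3 + c(|i| + 1))`, where
  `τ̲ⁱα = (α₀, irα₀ + α₁, sⁱα₂)` (`tauVecK`), by clearing denominators (`logHeight` is invariant
  under scaling) and the previous items. With `deg Z = [ℚ(α):ℚ] = totalWeight` this is the shape
  `h(τⁱZ) ≤ h(Z) + c₄|i| deg Z` (`i ≠ 0`) consumed by `NguyenRoy.EndgameData.ht_τV_le`, once `h(Z)`
  is compared with `[ℚ(α):ℚ] h_abs(α)` (the other half of Lemma 11, §4 of the paper, not done here).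

## References

* [NguyenRoy2016] N. A. V. Nguyen, D. Roy, IJNT 12 (2016) 1273–1293 = arXiv:1412.5163, §4, Lemma 11
  and its proof (the local estimate `‖τ̲(α)‖_v ≤ 2^{ε_v} max{1,|r|_v} max{1,|s|_v} ‖α‖_v`).
-/

noncomputable section

open Height Height.AdmissibleAbsValues Finset Function

namespace Literature.NumberTheory.Transcendental

namespace NguyenRoy

/-! ### Heights of integer tuples and of integer linear images -/

section general

variable {K : Type*} [Field K] [AdmissibleAbsValues K]

/-- **The height of an integer tuple**: if `|zᵢ| ≤ B` (`B ≥ 1`) then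
`logHeight_K(z) ≤ totalWeight K · log B`. [folklore] -/
theorem logHeight_intCast_le {ι : Type*} [Finite ι] (z : ι → ℤ) {B : ℝ} (hB1 : 1 ≤ B)
    (hB : ∀ i, (|z i| : ℝ) ≤ B) :
    logHeight (fun i => (z i : K)) ≤ totalWeight K * Real.log B := by
  have hlogB : 0 ≤ Real.log B := Real.log_nonneg hB1
  rcases eq_or_ne (fun i => (z i : K)) 0 with h0 | h0
  · rw [h0, logHeight_zero]; positivity
  have hne : Nonempty ι := by
    by_contra hι
    rw [not_nonempty_iff] at hι
    exact h0 (funext fun i => (hι.false i).elim)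
  -- local bounds
  have hloc : ∀ v : AbsoluteValue K ℝ, (⨆ i, v (z i : K)) ≤ B := fun v =>
    ciSup_le fun i => le_trans (by exact_mod_cast absValue_intCast_le v (z i)) (hB i)
  have hloc1 : ∀ v : AbsoluteValue K ℝ, IsNonarchimedean v → (⨆ i, v (z i : K)) ≤ 1 :=
    fun v hv => ciSup_le fun i => hv.apply_intCast_le_one
  have hnn : ∀ v : AbsoluteValue K ℝ, 0 ≤ ⨆ i, v (z i : K) := fun v =>
    Real.iSup_nonneg fun i => v.nonneg _
  -- `H(z) ≤ B^{totalWeight}`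
  have hmul : mulHeight (fun i => (z i : K)) ≤ B ^ totalWeight K := by
    rw [mulHeight_eq h0]
    have hA : (archAbsVal.map fun v : AbsoluteValue K ℝ => ⨆ i, v (z i : K)).prod ≤
        (archAbsVal.map fun _ : AbsoluteValue K ℝ => B).prod :=
      Multiset.prod_map_le_prod_map₀ _ _ (fun v _ => hnn v) fun v _ => hloc v
    rw [Multiset.map_const', Multiset.prod_replicate] at hA
    have hN : 0 ≤ (∏ᶠ v : nonarchAbsVal, ⨆ i, v.val (z i : K)) ∧
        (∏ᶠ v : nonarchAbsVal, ⨆ i, v.val (z i : K)) ≤ 1 := by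
      refine finprod_induction (fun x : ℝ => 0 ≤ x ∧ x ≤ 1) ⟨zero_le_one, le_rfl⟩
        (fun x y hx hy => ⟨mul_nonneg hx.1 hy.1, ?_⟩)
        fun v => ⟨hnn v.val, hloc1 v.val (isNonarchimedean _ v.prop)⟩
      calc x * y ≤ 1 * 1 := mul_le_mul hx.2 hy.2 hy.1 zero_le_one
        _ = 1 := mul_one 1
    rw [totalWeight]
    calc (archAbsVal.map fun v : AbsoluteValue K ℝ => ⨆ i, v (z i : K)).prod *
          ∏ᶠ v : nonarchAbsVal, ⨆ i, v.val (z i : K)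
        ≤ B ^ (Multiset.card (archAbsVal (K := K))) * 1 :=
          mul_le_mul hA hN.2 hN.1 (by positivity)
      _ = B ^ (Multiset.card (archAbsVal (K := K))) := mul_one _
  rw [logHeight_eq_log_mulHeight]
  calc Real.log (mulHeight fun i => (z i : K)) ≤ Real.log (B ^ totalWeight K) :=
        Real.log_le_log (mulHeight_pos _) hmul
    _ = totalWeight K * Real.log B := Real.log_pow _ _

/-- **The height of an integer linear image**: for an integer matrix `Z` with `|Z_{jk}| ≤ B`
(`B ≥ 1`), `logHeight_K(Z x) ≤ totalWeight K · (log #ι + log B) + logHeight_K(x)`. [folklore] -/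
theorem logHeight_intMatrix_apply_le {ι ι' : Type*} [Fintype ι] [Finite ι'] (Z : ι' × ι → ℤ)
    (x : ι → K) {B : ℝ} (hB1 : 1 ≤ B) (hB : ∀ p, (|Z p| : ℝ) ≤ B) :
    logHeight (fun j => ∑ i, (Z (j, i) : K) * x i) ≤
      totalWeight K * (Real.log (Nat.card ι) + Real.log B) + logHeight x := by
  have h := logHeight_linearMap_apply_le (fun p => (Z p : K)) x
  have hZ := logHeight_intCast_le (K := K) Z hB1 hB
  have e : (totalWeight K : ℝ) * (Real.log (Nat.card ι) + Real.log B) =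
      totalWeight K * Real.log (Nat.card ι) + totalWeight K * Real.log B := mul_add _ _ _
  linarith

end general

/-! ### Clearing the denominators of `(1, ir, sⁱ)` -/

/-- The constant `c(r, s) = log d + 1 + log max(1,|r|) + log max(|s|, |s|⁻¹)`,
`d = den(r) den(s) |num(s)|`, of the height estimate for the translates.
[cite: NguyenRoy2016, Lemma 11 (the constant c₄)] -/
def tauHtConst (r s : ℚ) : ℝ :=
  Real.log ((r.den * s.den * s.num.natAbs : ℕ) : ℝ) + 1 + Real.log (max 1 |(r : ℝ)|) +
    Real.log (max |(s : ℝ)| |(s : ℝ)|⁻¹)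

/-- `1 ≤ max(|s|, |s|⁻¹)` for `s ≠ 0`. [folklore] -/
theorem one_le_max_abs_inv {x : ℝ} (hx : x ≠ 0) : 1 ≤ max |x| |x|⁻¹ := by
  rcases le_or_gt 1 |x| with h | h
  · exact h.trans (le_max_left _ _)
  · have hpos : 0 < |x| := abs_pos.mpr hx
    exact (one_le_inv₀ hpos |>.mpr h.le).trans (le_max_right _ _)

/-- The four summands of `tauHtConst` are non-negative (for `s ≠ 0`). [folklore] -/
theorem tauHtConst_parts_nonneg (r s : ℚ) (hs : s ≠ 0) :
    0 ≤ Real.log ((r.den * s.den * s.num.natAbs : ℕ) : ℝ) ∧ 0 ≤ Real.log (max 1 |(r : ℝ)|) ∧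
      0 ≤ Real.log (max |(s : ℝ)| |(s : ℝ)|⁻¹) := by
  have hd : 1 ≤ r.den * s.den * s.num.natAbs :=
    Nat.one_le_iff_ne_zero.mpr (Nat.mul_ne_zero (Nat.mul_ne_zero r.den_ne_zero s.den_ne_zero)
      (Int.natAbs_ne_zero.mpr (Rat.num_ne_zero.mpr hs)))
  have hsR : (s : ℝ) ≠ 0 := by exact_mod_cast hs
  exact ⟨Real.log_nonneg (by exact_mod_cast hd), Real.log_nonneg (le_max_left _ _),
    Real.log_nonneg (one_le_max_abs_inv hsR)⟩

/-- **Clearing denominators**: for `s ≠ 0` and `i ∈ ℤ` there are integers `N ≥ 1`, `U`, `V` with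
`U = N·(ir)`, `V = N·sⁱ` in `ℚ` and `N, |U|, |V| ≤ exp(c(r,s)(|i| + 1))` (take `N = d^{|i|+1}`).
[cite: NguyenRoy2016, Lemma 11 (proof)] -/
theorem exists_int_clearing (r s : ℚ) (hs : s ≠ 0) (i : ℤ) :
    ∃ (N : ℕ) (U V : ℤ), 0 < N ∧ ((U : ℚ) = N * (i * r)) ∧ ((V : ℚ) = N * s ^ i) ∧
      ((N : ℝ) ≤ Real.exp (tauHtConst r s * (|(i : ℝ)| + 1))) ∧
      ((|U| : ℝ) ≤ Real.exp (tauHtConst r s * (|(i : ℝ)| + 1))) ∧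
      ((|V| : ℝ) ≤ Real.exp (tauHtConst r s * (|(i : ℝ)| + 1))) := by
  obtain ⟨hLd, hLr, hLs⟩ := tauHtConst_parts_nonneg r s hs
  set d : ℕ := r.den * s.den * s.num.natAbs with hd
  have hnum : s.num ≠ 0 := Rat.num_ne_zero.mpr hs
  have hd0 : 0 < d := Nat.pos_of_ne_zero (Nat.mul_ne_zero
    (Nat.mul_ne_zero r.den_ne_zero s.den_ne_zero) (Int.natAbs_ne_zero.mpr hnum))
  have hdR : (0 : ℝ) < d := by exact_mod_cast hd0
  have hsR : (s : ℝ) ≠ 0 := by exact_mod_cast hs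
  have hsQ : (s : ℚ) ≠ 0 := hs
  -- the rational identities `d·r ∈ ℤ`, `d·s ∈ ℤ`, `d/s ∈ ℤ`
  have hnat : ((s.num.natAbs : ℕ) : ℚ) = |(s.num : ℚ)| := by rw [Nat.cast_natAbs, Int.cast_abs]
  have hdQ : ((d : ℕ) : ℚ) = (r.den : ℚ) * (s.den : ℚ) * |(s.num : ℚ)| := by
    rw [hd]; push_cast; rw [hnat]
  have hdr : ((d : ℕ) : ℚ) * r = (r.num : ℚ) * (s.den : ℚ) * |(s.num : ℚ)| := by
    rw [hdQ]
    have := Rat.mul_den_eq_num r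
    calc (r.den : ℚ) * s.den * |(s.num : ℚ)| * r = (r * r.den) * s.den * |(s.num : ℚ)| := by ring
      _ = r.num * s.den * |(s.num : ℚ)| := by rw [this]
  have hds : ((d : ℕ) : ℚ) * s = (r.den : ℚ) * |(s.num : ℚ)| * (s.num : ℚ) := by
    rw [hdQ]
    have := Rat.mul_den_eq_num s
    calc (r.den : ℚ) * s.den * |(s.num : ℚ)| * s = r.den * |(s.num : ℚ)| * (s * s.den) := by ring
      _ = r.den * |(s.num : ℚ)| * s.num := by rw [this]
  have hsign : |(s.num : ℚ)| = (s.num.sign : ℚ) * (s.num : ℚ) := by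
    have h' : s.num.sign * s.num = |s.num| := by
      rw [Int.sign_mul_self_eq_natAbs, Int.natCast_natAbs]
    exact_mod_cast h'.symm
  have hdivs' : ((d : ℕ) : ℚ) = ((r.den : ℚ) * (s.den : ℚ) ^ 2 * (s.num.sign : ℚ)) * s := by
    rw [hdQ, hsign]
    have h1 := Rat.mul_den_eq_num s
    calc (r.den : ℚ) * s.den * (s.num.sign * s.num) = r.den * s.den * (s.num.sign * (s * s.den)) := by
          rw [h1]
      _ = r.den * (s.den : ℚ) ^ 2 * s.num.sign * s := by ring
  have hdivs : ((d : ℕ) : ℚ) / s = (r.den : ℚ) * (s.den : ℚ) ^ 2 * (s.num.sign : ℚ) := by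
    rw [div_eq_iff hsQ]
    exact hdivs'
  -- real bounds for the building blocks
  set n : ℕ := i.natAbs with hn
  have hiR : |(i : ℝ)| = n := by
    rw [hn, Nat.cast_natAbs, Int.cast_abs]
  set c : ℝ := tauHtConst r s with hc
  have hcdef : c = Real.log d + 1 + Real.log (max 1 |(r : ℝ)|) +
      Real.log (max |(s : ℝ)| |(s : ℝ)|⁻¹) := by rw [hc, tauHtConst, hd]
  set Ms : ℝ := max |(s : ℝ)| |(s : ℝ)|⁻¹ with hMs
  have hMs1 : 1 ≤ Ms := one_le_max_abs_inv hsR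
  have hMspos : 0 < Ms := by linarith
  have hdpow : ∀ k : ℕ, ((d : ℝ)) ^ k = Real.exp (k * Real.log d) := fun k => by
    rw [Real.exp_nat_mul, Real.exp_log hdR]
  have hN_le : ((d : ℝ)) ^ (n + 1) ≤ Real.exp (c * (n + 1)) := by
    rw [hdpow]
    apply Real.exp_le_exp.mpr
    rw [hcdef]
    push_cast
    nlinarith
  have hr_le : |(r : ℝ)| ≤ Real.exp (Real.log (max 1 |(r : ℝ)|)) := by
    rw [Real.exp_log (lt_of_lt_of_le one_pos (le_max_left _ _))]
    exact le_max_right _ _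
  have hn_le : (n : ℝ) ≤ Real.exp n := by
    have := Real.add_one_le_exp (n : ℝ); linarith
  -- `|sⁱ| ≤ Ms^n = exp(n log Ms)`
  have habszpow : |(s : ℝ)| ^ i ≤ Real.exp (n * Real.log Ms) := by
    rw [Real.exp_nat_mul, Real.exp_log hMspos]
    rcases Int.eq_nat_or_neg i with ⟨n', hn' | hn'⟩
    · have hnn' : n = n' := by rw [hn, hn']; simp
      rw [hn', zpow_natCast, hnn']
      exact pow_le_pow_left₀ (abs_nonneg _) (le_max_left _ _) n'
    · have hnn' : n = n' := by rw [hn, hn']; simp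
      rw [hn', zpow_neg, zpow_natCast, ← inv_pow, hnn']
      exact pow_le_pow_left₀ (inv_nonneg.mpr (abs_nonneg _)) (le_max_right _ _) n'
  -- bounds for `U`, `V` from the defining identities
  have hboundU : ∀ U : ℤ, (U : ℚ) = ((d ^ (n + 1) : ℕ) : ℚ) * (i * r) →
      (|U| : ℝ) ≤ Real.exp (c * (n + 1)) := by
    intro U hU
    have hU' : (U : ℝ) = ((d : ℝ)) ^ (n + 1) * ((i : ℝ) * (r : ℝ)) := by
      have := congrArg (Rat.cast : ℚ → ℝ) hU
      push_cast at this
      exact this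
    have habs : (|U| : ℝ) = ((d : ℝ)) ^ (n + 1) * (n * |(r : ℝ)|) := by
      rw [hU', abs_mul, abs_mul, abs_of_nonneg (by positivity : (0 : ℝ) ≤ (d : ℝ) ^ (n + 1)), hiR]
    rw [habs]
    calc ((d : ℝ)) ^ (n + 1) * (n * |(r : ℝ)|)
        ≤ Real.exp ((n + 1 : ℕ) * Real.log d) * (Real.exp n * Real.exp (Real.log (max 1 |(r : ℝ)|))) := by
          rw [hdpow]
          exact mul_le_mul_of_nonneg_left (mul_le_mul hn_le hr_le (abs_nonneg _) (by positivity))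
            (Real.exp_pos _).le
      _ = Real.exp ((n + 1 : ℕ) * Real.log d + n + Real.log (max 1 |(r : ℝ)|)) := by
          rw [Real.exp_add, Real.exp_add, mul_assoc]
      _ ≤ Real.exp (c * (n + 1)) := by
          apply Real.exp_le_exp.mpr
          rw [hcdef]
          push_cast
          nlinarith
  have hboundV : ∀ V : ℤ, (V : ℚ) = ((d ^ (n + 1) : ℕ) : ℚ) * s ^ i →
      (|V| : ℝ) ≤ Real.exp (c * (n + 1)) := by
    intro V hV
    have hV' : (V : ℝ) = ((d : ℝ)) ^ (n + 1) * (s : ℝ) ^ i := by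
      have := congrArg (Rat.cast : ℚ → ℝ) hV
      push_cast at this
      exact this
    have habs : (|V| : ℝ) = ((d : ℝ)) ^ (n + 1) * |(s : ℝ)| ^ i := by
      rw [hV', abs_mul, abs_zpow, abs_of_nonneg (by positivity : (0 : ℝ) ≤ (d : ℝ) ^ (n + 1))]
    rw [habs]
    calc ((d : ℝ)) ^ (n + 1) * |(s : ℝ)| ^ i
        ≤ Real.exp ((n + 1 : ℕ) * Real.log d) * Real.exp (n * Real.log Ms) := by
          rw [hdpow]
          exact mul_le_mul_of_nonneg_left habszpow (Real.exp_pos _).le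
      _ = Real.exp ((n + 1 : ℕ) * Real.log d + n * Real.log Ms) := by rw [Real.exp_add]
      _ ≤ Real.exp (c * (n + 1)) := by
          apply Real.exp_le_exp.mpr
          rw [hcdef]
          push_cast
          have hlMs : 0 ≤ Real.log Ms := Real.log_nonneg hMs1
          nlinarith
  have hNR : (((d ^ (n + 1) : ℕ) : ℕ) : ℝ) ≤ Real.exp (c * (n + 1)) := by
    push_cast; exact hN_le
  -- the two cases `i = n'`, `i = -n'`
  rw [hiR]
  rcases Int.eq_nat_or_neg i with ⟨n', hn' | hn'⟩
  · -- `i = n' ≥ 0`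
    have hnn' : n = n' := by rw [hn, hn']; simp
    have hUq : (((d : ℤ) ^ n' * (n' : ℤ) * (r.num * (s.den : ℤ) * |s.num|) : ℤ) : ℚ) =
        ((d ^ (n + 1) : ℕ) : ℚ) * (i * r) := by
      rw [hn', hnn']
      push_cast
      rw [← hdr]
      ring
    have hVq : (((d : ℤ) * ((r.den : ℤ) * |s.num| * s.num) ^ n' : ℤ) : ℚ) =
        ((d ^ (n + 1) : ℕ) : ℚ) * s ^ i := by
      rw [hn', hnn', zpow_natCast]
      push_cast
      rw [← hds]
      ring
    exact ⟨d ^ (n + 1), _, _, pow_pos hd0 _, hUq, hVq, hNR, hboundU _ hUq, hboundV _ hVq⟩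
  · -- `i = -n' < 0`
    have hnn' : n = n' := by rw [hn, hn']; simp
    have hUq : ((-((d : ℤ) ^ n' * (n' : ℤ) * (r.num * (s.den : ℤ) * |s.num|)) : ℤ) : ℚ) =
        ((d ^ (n + 1) : ℕ) : ℚ) * (i * r) := by
      rw [hn', hnn']
      push_cast
      rw [← hdr]
      ring
    have hVq : (((d : ℤ) * ((r.den : ℤ) * (s.den : ℤ) ^ 2 * s.num.sign) ^ n' : ℤ) : ℚ) =
        ((d ^ (n + 1) : ℕ) : ℚ) * s ^ i := by
      rw [hn', hnn', zpow_neg, zpow_natCast]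
      push_cast
      rw [← hdivs, div_pow]
      ring
    exact ⟨d ^ (n + 1), _, _, pow_pos hd0 _, hUq, hVq, hNR, hboundU _ hUq, hboundV _ hVq⟩

/-! ### The height of a translate -/

/-- The translate `τ̲ⁱα = (α₀, irα₀ + α₁, sⁱα₂)` of a point `α ∈ K³` (`r, s ∈ ℚ ⊂ K`).
[cite: NguyenRoy2016, §2 (τ̲) and Lemma 11] -/
def tauVecK {K : Type*} [Field K] [CharZero K] (r s : ℚ) (i : ℤ) (α : Fin 3 → K) : Fin 3 → K :=
  ![α 0, (((i : ℚ) * r : ℚ) : K) * α 0 + α 1, ((s ^ i : ℚ) : K) * α 2]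

/-- `τ̲⁰α = α`. [folklore] -/
theorem tauVecK_zero {K : Type*} [Field K] [CharZero K] (r s : ℚ) (α : Fin 3 → K) :
    tauVecK r s 0 α = α := by
  ext j
  fin_cases j <;> simp [tauVecK]

/-- **Lemma 11, Weil-height half** (Nguyen–Roy 2016): for a number field `K`, `α ∈ K³`,
`r, s ∈ ℚ` with `s ≠ 0` and `i ∈ ℤ`,
`logHeight_K(τ̲ⁱα) ≤ logHeight_K(α) + totalWeight K · (log 3 + c(r,s)(|i| + 1))`
(`totalWeight K = [K:ℚ]`; the paper: `h_abs(τ̲(α)) ≤ c + h_abs(α)` with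
`c = log 2 + h_abs(1,r) + h_abs(1,s)`, iterated `|i|` times). [cite: NguyenRoy2016, Lemma 11] -/
theorem logHeight_tauVecK_le {K : Type*} [Field K] [NumberField K] (r s : ℚ) (hs : s ≠ 0)
    (i : ℤ) (α : Fin 3 → K) :
    logHeight (tauVecK r s i α) ≤
      logHeight α + totalWeight K * (Real.log 3 + tauHtConst r s * (|(i : ℝ)| + 1)) := by
  obtain ⟨N, U, V, hN, hU, hV, hNle, hUle, hVle⟩ := exists_int_clearing r s hs i
  set B : ℝ := Real.exp (tauHtConst r s * (|(i : ℝ)| + 1)) with hB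
  have hB1 : 1 ≤ B := by
    have : (1 : ℝ) ≤ N := by exact_mod_cast hN
    exact this.trans hNle
  -- the integer matrix of `N · τ̲ⁱ`
  let Z : Fin 3 × Fin 3 → ℤ := fun p => (!![(N : ℤ), 0, 0; U, N, 0; 0, 0, V] : Matrix (Fin 3) (Fin 3) ℤ) p.1 p.2
  have hZ : ∀ p, (|Z p| : ℝ) ≤ B := by
    have h0B : (0 : ℝ) ≤ B := le_trans zero_le_one hB1
    rintro ⟨a, b⟩
    fin_cases a <;> fin_cases b <;> simp [Z] <;>
      first | exact h0B | exact hNle | exact hUle | exact hVle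
  have hNK : ((N : ℕ) : K) ≠ 0 := by exact_mod_cast hN.ne'
  have hsmul : ((N : ℕ) : K) • tauVecK r s i α = fun j => ∑ k, (Z (j, k) : K) * α k := by
    have hUK : ((U : ℤ) : K) = ((N : ℕ) : K) * ((((i : ℚ) * r : ℚ)) : K) := by
      have := congrArg (Rat.cast : ℚ → K) hU
      push_cast at this ⊢
      exact this
    have hVK : ((V : ℤ) : K) = ((N : ℕ) : K) * (((s ^ i : ℚ)) : K) := by
      have := congrArg (Rat.cast : ℚ → K) hV
      push_cast at this ⊢
      exact this
    ext j
    fin_cases j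
    · simp [tauVecK, Z, Fin.sum_univ_three]
    · simp [tauVecK, Z, Fin.sum_univ_three, hUK]
      ring
    · simp [tauVecK, Z, Fin.sum_univ_three, hVK]
      ring
  have hmain := logHeight_intMatrix_apply_le (K := K) Z α hB1 hZ
  rw [← hsmul, logHeight_smul_eq_logHeight _ hNK] at hmain
  have hcard : (Nat.card (Fin 3) : ℝ) = 3 := by simp
  rw [hcard, hB, Real.log_exp] at hmain
  linarith

end NguyenRoy

end Literature.NumberTheory.Transcendental

end
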